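import Summits.AtomisticToContinuum.Crystallization.Theses.IsometryAtoms

/-!
# `IsometryAtoms.PeriodicSupportToHinge` (item stmt-AtomisticToContinuum-15779) — proved

Route `route-AtomisticToContinuum-IsometryAtoms`, sub-problem `Crystallization`; the route's GLUE
to the hinge (rank 9, size M).  CRUX = `PeriodicSupportToHinge := PS → BS → EL → HINGE`:
* `PS`    — every minimising (`E_P[h_LJ] ≤ e* := ⨅_Q e(Q)`), point-stationary, a.s. `δ`-hard-core
  probability law `P` on rooted configurations of `ℝ³` charges, for ONE periodic `Q` and at every
  scale `(R, ε)`, the two-way matching event `T_Q(R, ε)` with positive (outer) `P`-measure;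
* `BS`    — the Benjamini–Schramm limit of ground states (item 9230, a tree theorem) with its
  DENSITY-TRANSFER clause, a hypothesis here;
* `EL`    — `E(N)/N → e*` (item 0626, a tree theorem), a hypothesis here;
* `HINGE` — every Lennard-Jones ground-state sequence charges ONE periodic `Q` with density
  `ρ > 0` at every scale `(R, ε)`, frequently in `N` (the statement of `GroundStatesChargePeriodic`,
  stmt-2911, inlined).

PROOF (portmanteau / density transfer; radius `R + ε/2`, tolerance `ε/2` on both sides).
Given ground states `x`, `BS` gives `φ, δ, P`; `EL ∘ φ` and uniqueness of limits make `P`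
minimising; `PS` gives `Q`; at scale `(R, ε)` the event `T := T_Q(R + ε/2, ε/2)` has `P T > 0`;
`windowTransfer` (two two-way matchings compose: triangle inequality twice, `‖A v‖ = ‖v‖`)
turns "recentred configuration of particle `i` matched to some `ν ∈ T`" into "the `R`-window of
`x_i` is `ε`-matched with `x_i + A(Q.points − q)`"; `densityHandover` turns the eventual
density bound along `φ` (transfer clause at `ρ := P(T).toReal/2`) into a frequent-in-`N` one.
Measurability of `T` is never needed (both `PS` and the transfer clause speak of the outer measure
of an arbitrary set), which disposes of the item's recorded why-might-fail.

Provenance.  This is the registered line `Cruxes/PeriodicSupportToHinge/Lines/complete.lean`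
(planner-skel-…-15779-0 skeleton `birth`; stubs proved by the crux strategist b1, 2026-08-17),
landed by the line lead with the namespace of the Theorems tree; the twin glue
`BenjaminiSchrammPeriodicSupport.SupportToHinge` (stmt-12748, definitionally the same statement)
is deliberately NOT restated here so that this route's import cone stays free of
`Theses.BenjaminiSchrammPeriodicSupport` (route repair rev 4).
References: D. Aldous, R. Lyons, EJP 12 (2007) §2 [AldousLyons2007]; D. Aldous, J. M. Steele,
*The objective method* (2004) [AldousSteele2004]; X. Blanc, M. Lewin, EMS Surv. Math. Sci. 2
(2015) §2.1 [BlancLewin2015].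
-/

noncomputable section

open MeasureTheory Filter
open scoped ENNReal Topology
open Literature.MathematicalPhysics.StatisticalMechanics
open Literature.Probability.Process

namespace Summit.AtomisticToContinuum.Crystallization.Theorems

namespace IsometryAtomsPeriodicSupportToHinge

/-! ## The two lemmas of the skeleton `birth` (window transfer; density hand-over) -/

/-- **Window transfer: two two-way matchings compose (deterministic geometry).** Let `Λ ⊂ ℝ³`,
`q ∈ ℝ³`, `ε > 0`, a finite configuration `x : Fin N → ℝ³` with a marked particle `i`, a
configuration-measure `ν` and a linear isometry `A`. If (law side) `Λ ∩ B_{R+ε/2}(q)` is two-way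
`ε/2`-matched with the atoms of `ν` through `s ↦ A (s - q)`, and (transfer side) the atoms of `ν`
of norm `≤ R + ε/2` are two-way `ε/2`-matched with the differences `x k - x i`, then the
`R`-neighbourhood of `x i` is two-way `ε`-matched with `x i + A (Λ - q)`.  Triangle inequality
twice; the intermediate partner of a point of norm `≤ R` has norm `≤ R + ε/2`; `‖A (s - q)‖ =
dist s q`. [folklore] -/
theorem windowTransfer :
    ∀ (Λ : Set (EuclideanSpace ℝ (Fin 3))) (q : EuclideanSpace ℝ (Fin 3)) (R ε : ℝ), 0 < ε →
      ∀ (N : ℕ) (x : Fin N → EuclideanSpace ℝ (Fin 3)) (i : Fin N)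
        (ν : Measure (EuclideanSpace ℝ (Fin 3)))
        (A : EuclideanSpace ℝ (Fin 3) →ₗᵢ[ℝ] EuclideanSpace ℝ (Fin 3)),
        (∀ s ∈ Λ, dist s q ≤ R + ε / 2 →
          ∃ y : EuclideanSpace ℝ (Fin 3), ν {y} ≠ 0 ∧ dist y (A (s - q)) ≤ ε / 2) →
        (∀ y : EuclideanSpace ℝ (Fin 3), ν {y} ≠ 0 → ‖y‖ ≤ R + ε / 2 →
          ∃ s ∈ Λ, dist y (A (s - q)) ≤ ε / 2) →
        (∀ p : EuclideanSpace ℝ (Fin 3), ν {p} ≠ 0 → ‖p‖ ≤ R + ε / 2 →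
          ∃ d ∈ Set.range (fun k : Fin N => x k - x i), dist d p ≤ ε / 2) →
        (∀ d ∈ Set.range (fun k : Fin N => x k - x i), ‖d‖ ≤ R + ε / 2 →
          ∃ p : EuclideanSpace ℝ (Fin 3), ν {p} ≠ 0 ∧ dist d p ≤ ε / 2) →
        (∀ s ∈ Λ, dist s q ≤ R → ∃ j : Fin N, dist (x j) (x i + A (s - q)) ≤ ε) ∧
        (∀ j : Fin N, dist (x j) (x i) ≤ R → ∃ s ∈ Λ, dist (x j) (x i + A (s - q)) ≤ ε) := by
  intro Λ q R ε hε N x i ν A hQ1 hQ2 h1 h2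
  have hkey : ∀ (j : Fin N) (s : EuclideanSpace ℝ (Fin 3)),
      dist (x j) (x i + A (s - q)) = dist (x j - x i) (A (s - q)) := by
    intro j s
    rw [dist_eq_norm, dist_eq_norm, sub_add_eq_sub_sub]
  have hnA : ∀ s : EuclideanSpace ℝ (Fin 3), ‖A (s - q)‖ = dist s q := by
    intro s
    rw [LinearIsometry.norm_map, dist_eq_norm]
  constructor
  · intro s hs hsR
    obtain ⟨y, hy, hyd⟩ := hQ1 s hs (by linarith)
    have hyn : ‖y‖ ≤ R + ε / 2 := by
      calc ‖y‖ = dist y 0 := (dist_zero_right _).symm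
        _ ≤ dist y (A (s - q)) + dist (A (s - q)) 0 := dist_triangle _ _ _
        _ ≤ ε / 2 + R := by
            rw [dist_zero_right, hnA]; exact add_le_add hyd hsR
        _ = R + ε / 2 := by ring
    obtain ⟨d, ⟨k, rfl⟩, hk⟩ := h1 y hy hyn
    refine ⟨k, ?_⟩
    rw [hkey]
    calc dist (x k - x i) (A (s - q)) ≤ dist (x k - x i) y + dist y (A (s - q)) :=
          dist_triangle _ _ _
      _ ≤ ε / 2 + ε / 2 := add_le_add hk hyd
      _ = ε := by ring
  · intro j hj
    have hd : x j - x i ∈ Set.range (fun k : Fin N => x k - x i) := ⟨j, rfl⟩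
    have hdn : ‖x j - x i‖ ≤ R + ε / 2 := by
      rw [← dist_eq_norm]; linarith
    obtain ⟨p, hp, hpd⟩ := h2 _ hd hdn
    have hpn : ‖p‖ ≤ R + ε / 2 := by
      calc ‖p‖ = dist p 0 := (dist_zero_right _).symm
        _ ≤ dist p (x j - x i) + dist (x j - x i) 0 := dist_triangle _ _ _
        _ ≤ ε / 2 + R := by
            rw [dist_zero_right, dist_comm, ← dist_eq_norm]; exact add_le_add hpd hj
        _ = R + ε / 2 := by ring
    obtain ⟨s, hs, hsd⟩ := hQ2 p hp hpn
    refine ⟨s, hs, ?_⟩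
    rw [hkey]
    calc dist (x j - x i) (A (s - q)) ≤ dist (x j - x i) p + dist p (A (s - q)) :=
          dist_triangle _ _ _
      _ ≤ ε / 2 + ε / 2 := add_le_add hpd hsd
      _ = ε := by ring

/-- **Density hand-over along the Benjamini–Schramm subsequence (portmanteau bookkeeping).**
`P` a probability law, `0 < P T`, `StrictMono φ`, index predicates `S ⊆ S'`: if for every
`ρ < P(T).toReal` eventually in `j` at least `ρ·φ j` indices of `Fin (φ j)` satisfy `S`, then for
`ρ := P(T).toReal / 2 > 0`, FREQUENTLY in `N`, at least `ρ·N` indices of `Fin N` satisfy `S'`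
(`Nat.card` monotone under the inclusion; eventually along `φ → ∞` is frequently in `N`).
[folklore] -/
theorem densityHandover :
    ∀ (P : Measure (Measure (EuclideanSpace ℝ (Fin 3)))), IsProbabilityMeasure P →
      ∀ (T : Set (Measure (EuclideanSpace ℝ (Fin 3)))), 0 < P T →
      ∀ (φ : ℕ → ℕ), StrictMono φ →
      ∀ (S S' : (N : ℕ) → Fin N → Prop), (∀ (N : ℕ) (i : Fin N), S N i → S' N i) →
        (∀ ρ : ℝ, ρ < (P T).toReal → ∀ᶠ j : ℕ in Filter.atTop,
          ρ * (φ j : ℝ) ≤ (Nat.card {i : Fin (φ j) // S (φ j) i} : ℝ)) →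
        ∃ ρ : ℝ, 0 < ρ ∧ ∃ᶠ N : ℕ in Filter.atTop,
          ρ * (N : ℝ) ≤ (Nat.card {i : Fin N // S' N i} : ℝ) := by
  intro P hP T hT φ hφ S S' hSS' htr
  have hTreal : 0 < (P T).toReal := ENNReal.toReal_pos hT.ne' (measure_ne_top P T)
  refine ⟨(P T).toReal / 2, half_pos hTreal, ?_⟩
  have hev := htr ((P T).toReal / 2) (half_lt_self hTreal)
  have hev' : ∀ᶠ j : ℕ in atTop,
      (P T).toReal / 2 * ((φ j : ℕ) : ℝ) ≤ (Nat.card {i : Fin (φ j) // S' (φ j) i} : ℝ) := by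
    filter_upwards [hev] with j hj
    refine hj.trans ?_
    exact_mod_cast Nat.card_le_card_of_injective _
      (Subtype.map_injective (fun i hi => hSS' (φ j) i hi) Function.injective_id)
  exact hφ.tendsto_atTop.frequently
    (p := fun N : ℕ => (P T).toReal / 2 * (N : ℝ) ≤ (Nat.card {i : Fin N // S' N i} : ℝ))
    hev'.frequently

/-! ## The assembly: lemma₁ → lemma₂ → the crux (the registered skeleton `birth`) -/

/-- **The crux from the two stub statements** (conclusion = the body of
`IsometryAtoms.PeriodicSupportToHinge` verbatim).  Given ground states `x`: `BS` gives `φ, δ, P`;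
`EL` along `φ` and uniqueness of limits make `P` minimising; `PS` gives the periodic `Q`; at scale
`(R, ε)` the event `T := T_Q(R + ε/2, ε/2)` has `P T > 0`; stub 2, fed with the transfer clause at
`(T, R + ε/2, ε/2)` and the inclusion "matched to some `ν ∈ T` ⇒ matched to `Q`" (stub 1 under the
binders), returns the hinge's density clause. -/
theorem PeriodicSupportToHinge_of_stubs :
    (∀ (Λ : Set (EuclideanSpace ℝ (Fin 3))) (q : EuclideanSpace ℝ (Fin 3)) (R ε : ℝ), 0 < ε →
      ∀ (N : ℕ) (x : Fin N → EuclideanSpace ℝ (Fin 3)) (i : Fin N)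
        (ν : Measure (EuclideanSpace ℝ (Fin 3)))
        (A : EuclideanSpace ℝ (Fin 3) →ₗᵢ[ℝ] EuclideanSpace ℝ (Fin 3)),
        (∀ s ∈ Λ, dist s q ≤ R + ε / 2 →
          ∃ y : EuclideanSpace ℝ (Fin 3), ν {y} ≠ 0 ∧ dist y (A (s - q)) ≤ ε / 2) →
        (∀ y : EuclideanSpace ℝ (Fin 3), ν {y} ≠ 0 → ‖y‖ ≤ R + ε / 2 →
          ∃ s ∈ Λ, dist y (A (s - q)) ≤ ε / 2) →
        (∀ p : EuclideanSpace ℝ (Fin 3), ν {p} ≠ 0 → ‖p‖ ≤ R + ε / 2 →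
          ∃ d ∈ Set.range (fun k : Fin N => x k - x i), dist d p ≤ ε / 2) →
        (∀ d ∈ Set.range (fun k : Fin N => x k - x i), ‖d‖ ≤ R + ε / 2 →
          ∃ p : EuclideanSpace ℝ (Fin 3), ν {p} ≠ 0 ∧ dist d p ≤ ε / 2) →
        (∀ s ∈ Λ, dist s q ≤ R → ∃ j : Fin N, dist (x j) (x i + A (s - q)) ≤ ε) ∧
        (∀ j : Fin N, dist (x j) (x i) ≤ R → ∃ s ∈ Λ, dist (x j) (x i + A (s - q)) ≤ ε)) →
    (∀ (P : Measure (Measure (EuclideanSpace ℝ (Fin 3)))), IsProbabilityMeasure P →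
      ∀ (T : Set (Measure (EuclideanSpace ℝ (Fin 3)))), 0 < P T →
      ∀ (φ : ℕ → ℕ), StrictMono φ →
      ∀ (S S' : (N : ℕ) → Fin N → Prop), (∀ (N : ℕ) (i : Fin N), S N i → S' N i) →
        (∀ ρ : ℝ, ρ < (P T).toReal → ∀ᶠ j : ℕ in Filter.atTop,
          ρ * (φ j : ℝ) ≤ (Nat.card {i : Fin (φ j) // S (φ j) i} : ℝ)) →
        ∃ ρ : ℝ, 0 < ρ ∧ ∃ᶠ N : ℕ in Filter.atTop,
          ρ * (N : ℝ) ≤ (Nat.card {i : Fin N // S' N i} : ℝ)) →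
    -- the crux `IsometryAtoms.PeriodicSupportToHinge`, body verbatim: PS → BS → EL → HINGE
    (∀ δ : ℝ, 0 < δ → ∀ P : Measure (Measure (EuclideanSpace ℝ (Fin 3))), IsProbabilityMeasure P →
      (∀ᵐ μ ∂P, IsRootedHardCore δ μ) → IsPointStationaryLaw P →
      (∫ μ, rootEnergy lennardJones μ ∂P) ≤
        (⨅ Q : PeriodicConfiguration 3, Q.energyPerParticle lennardJones) →
      ∃ Q : PeriodicConfiguration 3, ∀ R ε : ℝ, 0 < R → 0 < ε →
        0 < P {μ | ∃ A : EuclideanSpace ℝ (Fin 3) →ₗᵢ[ℝ] EuclideanSpace ℝ (Fin 3), ∃ q ∈ Q.points,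
          (∀ s ∈ Q.points, dist s q ≤ R →
            ∃ y : EuclideanSpace ℝ (Fin 3), μ {y} ≠ 0 ∧ dist y (A (s - q)) ≤ ε) ∧
          (∀ y : EuclideanSpace ℝ (Fin 3), μ {y} ≠ 0 → ‖y‖ ≤ R →
            ∃ s ∈ Q.points, dist y (A (s - q)) ≤ ε)}) →
    (∀ x : (N : ℕ) → (Fin N → EuclideanSpace ℝ (Fin 3)), (∀ N, IsGroundState lennardJones (x N)) →
      ∃ φ : ℕ → ℕ, StrictMono φ ∧ ∃ δ : ℝ, 0 < δ ∧
        ∃ P : Measure (Measure (EuclideanSpace ℝ (Fin 3))), IsProbabilityMeasure P ∧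
          (∀ᵐ μ ∂P, IsRootedHardCore δ μ) ∧ IsPointStationaryLaw P ∧
          Filter.Tendsto (fun j : ℕ => groundStateEnergy lennardJones 3 (φ j) / (φ j : ℝ))
            Filter.atTop (nhds (∫ μ, rootEnergy lennardJones μ ∂P)) ∧
          ∀ T : Set (Measure (EuclideanSpace ℝ (Fin 3))), ∀ R ε : ℝ, 0 < ε → ∀ ρ : ℝ,
            ρ < (P T).toReal → ∀ᶠ j : ℕ in Filter.atTop, ρ * (φ j : ℝ) ≤
              (Nat.card {i : Fin (φ j) // ∃ ν ∈ T,
                ((∀ p : EuclideanSpace ℝ (Fin 3), ν {p} ≠ 0 → ‖p‖ ≤ R →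
                    ∃ q ∈ (Set.range (fun k : Fin (φ j) => x (φ j) k - x (φ j) i)), dist q p ≤ ε) ∧
                  (∀ q ∈ (Set.range (fun k : Fin (φ j) => x (φ j) k - x (φ j) i)), ‖q‖ ≤ R →
                    ∃ p : EuclideanSpace ℝ (Fin 3), ν {p} ≠ 0 ∧ dist q p ≤ ε))} : ℝ)) →
    (Filter.Tendsto (fun N : ℕ => groundStateEnergy lennardJones 3 N / N) Filter.atTop
      (nhds (⨅ Q : PeriodicConfiguration 3, Q.energyPerParticle lennardJones))) →
    ∀ x : (N : ℕ) → (Fin N → EuclideanSpace ℝ (Fin 3)), (∀ N, IsGroundState lennardJones (x N)) →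
      ∃ Q : PeriodicConfiguration 3, ∀ R ε : ℝ, 0 < R → 0 < ε → ∃ ρ : ℝ, 0 < ρ ∧
        ∃ᶠ N : ℕ in Filter.atTop, ρ * (N : ℝ) ≤ (Nat.card {i : Fin N //
          ∃ A : EuclideanSpace ℝ (Fin 3) →ₗᵢ[ℝ] EuclideanSpace ℝ (Fin 3), ∃ q ∈ Q.points,
            (∀ s ∈ Q.points, dist s q ≤ R → ∃ j : Fin N, dist (x N j) (x N i + A (s - q)) ≤ ε) ∧
            (∀ j : Fin N, dist (x N j) (x N i) ≤ R →
              ∃ s ∈ Q.points, dist (x N j) (x N i + A (s - q)) ≤ ε)} : ℝ) := by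
  intro hWT hDH hPS hBS hEL x hx
  -- the Benjamini–Schramm limit of the ground states along a subsequence (hypothesis `BS`)
  obtain ⟨φ, hφ, δ, hδ, P, hP, hcore, hstat, hE, htr⟩ := hBS x hx
  -- the limit law is minimising: `E_P[h] = lim E(φ j)/φ j = ⨅ e` (hypothesis `EL` along `φ`)
  have hlim' : Filter.Tendsto (fun j : ℕ => groundStateEnergy lennardJones 3 (φ j) / (φ j : ℝ))
      Filter.atTop (nhds (⨅ Q : PeriodicConfiguration 3, Q.energyPerParticle lennardJones)) :=
    hEL.comp hφ.tendsto_atTop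
  have hEq := tendsto_nhds_unique hE hlim'
  -- periodic support of the minimising law (hypothesis `PS`)
  obtain ⟨Q, hQ⟩ := hPS δ hδ P hP hcore hstat hEq.le
  refine ⟨Q, fun R ε hR hε => ?_⟩
  -- the law-level matching event at radius `R + ε/2`, tolerance `ε/2`
  set T : Set (Measure (EuclideanSpace ℝ (Fin 3))) :=
    {μ | ∃ A : EuclideanSpace ℝ (Fin 3) →ₗᵢ[ℝ] EuclideanSpace ℝ (Fin 3), ∃ q ∈ Q.points,
      (∀ s ∈ Q.points, dist s q ≤ R + ε / 2 →
        ∃ y : EuclideanSpace ℝ (Fin 3), μ {y} ≠ 0 ∧ dist y (A (s - q)) ≤ ε / 2) ∧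
      (∀ y : EuclideanSpace ℝ (Fin 3), μ {y} ≠ 0 → ‖y‖ ≤ R + ε / 2 →
        ∃ s ∈ Q.points, dist y (A (s - q)) ≤ ε / 2)} with hTdef
  have hT : 0 < P T := hQ (R + ε / 2) (ε / 2) (by positivity) (by positivity)
  -- stub 2: density hand-over, with the transfer clause of `BS` at `(T, R + ε/2, ε/2)`
  refine hDH P hP T hT φ hφ
    (fun N i => ∃ ν ∈ T,
      (∀ p : EuclideanSpace ℝ (Fin 3), ν {p} ≠ 0 → ‖p‖ ≤ R + ε / 2 →
        ∃ q ∈ (Set.range (fun k : Fin N => x N k - x N i)), dist q p ≤ ε / 2) ∧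
      (∀ q ∈ (Set.range (fun k : Fin N => x N k - x N i)), ‖q‖ ≤ R + ε / 2 →
        ∃ p : EuclideanSpace ℝ (Fin 3), ν {p} ≠ 0 ∧ dist q p ≤ ε / 2))
    (fun N i => ∃ A : EuclideanSpace ℝ (Fin 3) →ₗᵢ[ℝ] EuclideanSpace ℝ (Fin 3), ∃ q ∈ Q.points,
      (∀ s ∈ Q.points, dist s q ≤ R → ∃ j : Fin N, dist (x N j) (x N i + A (s - q)) ≤ ε) ∧
      (∀ j : Fin N, dist (x N j) (x N i) ≤ R →
        ∃ s ∈ Q.points, dist (x N j) (x N i + A (s - q)) ≤ ε))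
    ?_ (htr T (R + ε / 2) (ε / 2) (by positivity))
  -- the pointwise inclusion of the counted index sets is stub 1 under the binders
  intro N i hi
  obtain ⟨ν, hνT, hc, hd⟩ := hi
  obtain ⟨A, q, hq, ha, hb⟩ := hνT
  obtain ⟨he, hf⟩ := hWT Q.points q R ε hε N (x N) i ν A ha hb hc hd
  exact ⟨A, q, hq, he, hf⟩

end IsometryAtomsPeriodicSupportToHinge

/-! ## The crux, BY NAME -/

/-- **The crux `IsometryAtoms.PeriodicSupportToHinge` (stmt-AtomisticToContinuum-15779), proved**:
the two lemmas `windowTransfer` and `densityHandover` fed into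
`PeriodicSupportToHinge_of_stubs`. -/
theorem periodicSupportToHinge_proof :
    Summit.AtomisticToContinuum.Crystallization.Theses.IsometryAtoms.PeriodicSupportToHinge := by
  unfold Summit.AtomisticToContinuum.Crystallization.Theses.IsometryAtoms.PeriodicSupportToHinge
  exact IsometryAtomsPeriodicSupportToHinge.PeriodicSupportToHinge_of_stubs
    IsometryAtomsPeriodicSupportToHinge.windowTransfer
    IsometryAtomsPeriodicSupportToHinge.densityHandover

end Summit.AtomisticToContinuum.Crystallization.Theorems

end
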